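import Literature.Geometry.Kaehler.AnalyticSetSingularLocusCodim
import Literature.Geometry.Kaehler.AnalyticSetBranchLocus
import Mathlib.Geometry.Euclidean.Volume.Measure
import Mathlib.Topology.MetricSpace.HausdorffDimension
import HarnessLib

/-!
# Analytic sets of dimension `< p` are `𝓗^{2p}`-null

For an analytic subset `Z` of an open subset `Ω` of a finite-dimensional complex normed space `V`
(the setting of holomorphic chains, `Literature/Geometry/Kaehler/HolomorphicChain.lean`):

* `Literature.Geometry.Kaehler.IsAnalyticSet.euclideanHausdorffMeasure_image_eq_zero` — **if every
  regular point of `Z` has dimension `≤ d < p`, then `𝓗^{2p}(Z) = 0`** (`μHE[2 * p]` of the image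
  of `Z` in `V`). This is [Chirka1989, §3.7 Cor.: "`𝓗_{2p+ε}(A) = 0` for a `p`-dimensional
  analytic set"] in the form needed downstream (integer exponents), proved by induction on `d`:
  near a regular point of codimension `c` the set is the holomorphic image of a ball of
  `ℂ^{n-c}` (`SCV.IsRegPt.exists_goodNhd_finrank`, the good neighbourhoods of
  `AnalyticSetComponentsProofs.lean` with the dimension of the parameter space recorded), whose
  Hausdorff dimension is `≤ 2(n - c) < 2p` (`ContDiffOn.dimH_image_le`); the singular locus is
  analytic (Cartan–Whitney, `isAnalyticSet_singularLocus_holds`) with regular points of smaller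
  dimension (`IsAnalyticSet.succ_le_codim_singularLocus`), so the induction hypothesis applies.
* `Literature.Geometry.Kaehler.IsIrreducibleAnalyticSet.euclideanHausdorffMeasure_image_inter_eq_zero`
  — **two distinct irreducible analytic subsets of pure dimension `p` meet in an `𝓗^{2p}`-null
  set** [Chirka1989, §5.3 Cor. 1 with §3.7 Cor.]
  (`IsIrreducibleAnalyticSet.succ_le_codim_inter` + the above).

Also the dictionary between analytic subsets of the open submanifold `Ω` and their images in `V`
(private chart lemmas `Opens.extChartAt_val_apply`, `Opens.chartImage_val_eq`, duplicating
`Opens.extChartAt_apply`, `Opens.chartImage_eq` of `HolomorphicChainRectifiable.lean`, which is not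
imported here to keep this file free of currents; `IsRegularPointOfCodim.isRegPt_image_val`).

No named facts, no definitions.

## References

* E. M. Chirka, *Complex Analytic Sets*, Kluwer (1989), Ch. 1 §2.3, §3.7 Cor. (p. 39), §5.2
  Thm. 2, §5.3 Cor. 1 [Chirka1989].
-/

open Complex Metric Set Filter Function MeasureTheory MeasureTheory.Measure
open scoped Topology Manifold ENNReal

namespace Literature.Geometry.Kaehler

/-! ### Good neighbourhoods with the dimension of the parameter space -/

namespace SCV

variable {E : Type*} [NormedAddCommGroup E] [NormedSpace ℂ E]

/-- **Good neighbourhoods of a regular point, with the dimension of the parameter space**: the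
statement `IsRegPt.exists_goodNhd` of `AnalyticSetComponentsProofs.lean` (near a regular point of
codimension `p`, `Z` is the holomorphic image of a ball of the kernel `K` of the differential of
the defining map), recording in addition that `dim K + p = dim E`. Same proof.
[Chirka, *Complex Analytic Sets*, §2.3, A2.2] [folklore] -/
theorem IsRegPt.exists_goodNhd_finrank [FiniteDimensional ℂ E] {Z : Set E} {p : ℕ} {x : E}
    (h : IsRegPt Z p x) (hxZ : x ∈ Z) {N₀ : Set E} (hN₀ : N₀ ∈ 𝓝 x) :
    ∃ (N : Set E) (K : Submodule ℂ E) (ρ : ℝ) (Ψ₀ : K → E), x ∈ N ∧ N ⊆ N₀ ∧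
      Module.finrank ℂ K + p = Module.finrank ℂ E ∧ GoodNhd Z N p ρ Ψ₀ := by
  obtain ⟨U, hU, hxU, g, hg, hZU, hsurj⟩ := h
  have hgx : g x = 0 := by
    have : x ∈ U ∩ g ⁻¹' {0} := hZU ▸ ⟨hxZ, hxU⟩
    exact this.2
  -- shrink `U` into `N₀`
  obtain ⟨U₁, hU₁N, hU₁o, hxU₁⟩ := _root_.mem_nhds_iff.1 (Filter.inter_mem hN₀ (hU.mem_nhds hxU))
  have hU₁U : U₁ ⊆ U := fun y hy => (hU₁N hy).2
  have hg₁ : DifferentiableOn ℂ g U₁ := hg.mono hU₁U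
  -- straightening
  set K := LinearMap.ker ((fderiv ℂ g x : E →L[ℂ] (Fin p → ℂ)) : E →ₗ[ℂ] (Fin p → ℂ)) with hK
  have hKdim : Module.finrank ℂ K + p = Module.finrank ℂ E := by
    have h1 := LinearMap.finrank_range_add_finrank_ker
      ((fderiv ℂ g x : E →L[ℂ] (Fin p → ℂ)) : E →ₗ[ℂ] (Fin p → ℂ))
    rw [LinearMap.range_eq_top.2 hsurj, finrank_top, Module.finrank_fin_fun, ← hK] at h1
    omega
  obtain ⟨ψ, hbij⟩ := Literature.Analysis.Complex.SCV.exists_proj_ker_bijective (fderiv ℂ g x) hsurj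
  obtain ⟨S, T, Ψ, hSo, hxS, hSU, hTo, hΨd, hΦΨ, hΨΦ, hsurjS⟩ :=
    Literature.Analysis.Complex.SCV.exists_straightening hg₁ hU₁o hxU₁ ψ hbij
  -- a ball in `T` around `Φ x = (0, 0)`
  have hΦx : ((g x, ψ (x - x)) : (Fin p → ℂ) × K) = (0, 0) := by
    rw [hgx, sub_self, map_zero]
  have h0T : ((0, 0) : (Fin p → ℂ) × K) ∈ T := hΦx ▸ (hΦΨ x hxS).1
  obtain ⟨ρ, hρ, hρT⟩ := Metric.isOpen_iff.1 hTo _ h0T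
  -- the good neighbourhood
  set N : Set E := S ∩ (fun z => ((g z, ψ (z - x)) : (Fin p → ℂ) × K)) ⁻¹' ball (0, 0) ρ with hN
  have hΦc : ContinuousOn (fun z => ((g z, ψ (z - x)) : (Fin p → ℂ) × K)) S :=
    (hg₁.continuousOn.mono hSU).prodMk
      ((ψ.continuous.comp (continuous_id.sub continuous_const)).continuousOn)
  have hNo : IsOpen N := hΦc.isOpen_inter_preimage hSo isOpen_ball
  have hxN : x ∈ N := ⟨hxS, by rw [Set.mem_preimage, hΦx]; exact mem_ball_self hρ⟩
  refine ⟨N, K, ρ, fun k => Ψ (0, k), hxN, fun z hz => (hU₁N (hSU hz.1)).1, hKdim, ?_⟩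
  refine ⟨hNo, fun y hy => ?_, hρ, ?_, ?_⟩
  · -- regularity of the points of `Z ∩ N`
    refine ⟨S, hSo, hy.2.1, g, hg₁.mono hSU, ?_, ?_⟩
    · ext z
      constructor
      · rintro ⟨hzZ, hzS⟩
        exact ⟨hzS, (hZU.subset ⟨hzZ, hU₁U (hSU hzS)⟩).2⟩
      · rintro ⟨hzS, hgz⟩
        exact ⟨(hZU.symm.subset ⟨hU₁U (hSU hzS), hgz⟩).1, hzS⟩
    · intro c
      obtain ⟨v, hv⟩ := hsurjS y hy.2.1 (c, 0)
      exact ⟨v, congrArg Prod.fst hv⟩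
  · -- holomorphy of `Ψ₀`
    refine hΨd.comp (by fun_prop) fun k hk => hρT ?_
    rw [mem_ball, Prod.dist_eq] at *
    simpa using hk
  · -- `Ψ₀ '' ball = Z ∩ N`
    ext z
    constructor
    · rintro ⟨k, hk, rfl⟩
      have hkT : ((0 : Fin p → ℂ), k) ∈ ball ((0, 0) : (Fin p → ℂ) × K) ρ := by
        rw [mem_ball, Prod.dist_eq]; simpa using hk
      obtain ⟨hzS, hΦz⟩ := hΨΦ _ (hρT hkT)
      have hgz : g (Ψ (0, k)) = 0 := congrArg Prod.fst hΦz
      refine ⟨(hZU.symm.subset ⟨hU₁U (hSU hzS), hgz⟩).1, hzS, ?_⟩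
      rw [Set.mem_preimage, hΦz]; exact hkT
    · rintro ⟨hzZ, hzS, hzB⟩
      have hgz : g z = 0 := (hZU.subset ⟨hzZ, hU₁U (hSU hzS)⟩).2
      refine ⟨ψ (z - x), ?_, ?_⟩
      · have hle : dist (ψ (z - x)) 0 ≤ max (dist (0 : Fin p → ℂ) 0) (dist (ψ (z - x)) 0) :=
          le_max_right _ _
        rw [Set.mem_preimage, hgz, mem_ball, Prod.dist_eq] at hzB
        rw [mem_ball]
        exact lt_of_le_of_lt hle hzB
      · have := (hΦΨ z hzS).2
        rwa [hgz] at this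

/-- **Near a regular point of dimension `< k/2`, an analytic set is `𝓗ᵏ`-null.** If `x ∈ Z ⊆ E`
is a regular point of codimension `c` and `2 (dim E - c) < k`, then `𝓗ᵏ(Z ∩ N) = 0` for some
neighbourhood `N` of `x`: `Z ∩ N` is the `C¹` image of a ball in a real vector space of dimension
`2 (dim E - c)`, hence of Hausdorff dimension `< k` (`ContDiffOn.dimH_image_le`).
[Chirka, *Complex Analytic Sets*, §3.7 Cor.] [folklore] -/
theorem IsRegPt.exists_nhds_hausdorffMeasure_inter_eq_zero [FiniteDimensional ℂ E]
    [MeasurableSpace E] [BorelSpace E] {Z : Set E} {c : ℕ} {x : E} (h : IsRegPt Z c x)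
    (hxZ : x ∈ Z) {k : ℕ} (hk : 2 * (Module.finrank ℂ E - c) < k) :
    ∃ N ∈ 𝓝 x, μH[k] (Z ∩ N) = 0 := by
  obtain ⟨N, K, ρ, Ψ₀, hxN, -, hKdim, hG⟩ := h.exists_goodNhd_finrank hxZ univ_mem
  refine ⟨N, hG.isOpen.mem_nhds hxN, ?_⟩
  rw [← hG.image_eq, show ((k : ℕ) : ℝ) = ((k : NNReal) : ℝ) from rfl]
  apply hausdorffMeasure_of_dimH_lt
  have h1 : ContDiffOn ℝ 1 Ψ₀ (ball (0 : K) ρ) :=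
    (Literature.Analysis.Complex.SCV.contDiffOn_one hG.differentiableOn isOpen_ball).restrict_scalars ℝ
  have h2 : Module.finrank ℝ K < k := by
    rw [finrank_real_of_complex]
    omega
  calc dimH (Ψ₀ '' ball (0 : K) ρ) ≤ dimH (ball (0 : K) ρ) :=
        h1.dimH_image_le (convex_ball _ _) Subset.rfl
    _ ≤ dimH (univ : Set K) := dimH_mono (subset_univ _)
    _ = Module.finrank ℝ K := Real.dimH_univ_eq_finrank K
    _ < k := by exact_mod_cast h2

end SCV

/-! ### Analytic subsets of an open subset `Ω ⊆ V` and their images in `V` -/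

section OpensDictionary

variable {V : Type*} [NormedAddCommGroup V] [NormedSpace ℂ V] {Ω : TopologicalSpace.Opens V}

/-- The extended chart of the open submanifold `Ω ⊆ V` at any point is the inclusion. [folklore] -/
private theorem Opens.extChartAt_val_apply (y z : Ω) : extChartAt 𝓘(ℂ, V) y z = (z : V) := by
  simp [TopologicalSpace.Opens.chartAt_eq]

/-- The extended chart of `Ω ⊆ V` is defined everywhere. [folklore] -/
private theorem Opens.extChartAt_val_source (y : Ω) : (extChartAt 𝓘(ℂ, V) y).source = univ := by
  simp [TopologicalSpace.Opens.chartAt_eq]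

/-- Every point of `Ω` lies in the source of the extended chart. [folklore] -/
private theorem Opens.mem_extChartAt_val_source (y z : Ω) :
    z ∈ (extChartAt 𝓘(ℂ, V) y).source := by
  rw [Opens.extChartAt_val_source]; trivial

/-- Points of `Ω` lie in the target of the extended chart. [folklore] -/
private theorem Opens.mem_extChartAt_val_target (y z : Ω) :
    (z : V) ∈ (extChartAt 𝓘(ℂ, V) y).target := by
  have := (extChartAt 𝓘(ℂ, V) y).map_source (Opens.mem_extChartAt_val_source y z)
  rwa [Opens.extChartAt_val_apply] at this

/-- The inverse extended chart of `Ω ⊆ V` is the identity on `Ω`. [folklore] -/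
private theorem Opens.extChartAt_val_symm_apply (y z : Ω) :
    (extChartAt 𝓘(ℂ, V) y).symm z = z := by
  have := (extChartAt 𝓘(ℂ, V) y).left_inv (Opens.mem_extChartAt_val_source y z)
  rwa [Opens.extChartAt_val_apply] at this

/-- The target of the extended chart of `Ω ⊆ V` is `Ω`. [folklore] -/
private theorem Opens.extChartAt_val_target (y : Ω) :
    (extChartAt 𝓘(ℂ, V) y).target = (Ω : Set V) := by
  ext e
  constructor
  · intro he
    have h2 := (extChartAt 𝓘(ℂ, V) y).right_inv he
    rw [Opens.extChartAt_val_apply] at h2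
    rw [← h2]
    exact ((extChartAt 𝓘(ℂ, V) y).symm e).2
  · intro he
    exact Opens.mem_extChartAt_val_target y ⟨e, he⟩

/-- The inverse extended chart of `Ω ⊆ V`, followed by the inclusion, is the identity on `Ω`.
[folklore] -/
private theorem Opens.coe_extChartAt_val_symm (y : Ω) {e : V} (he : e ∈ (Ω : Set V)) :
    ((extChartAt 𝓘(ℂ, V) y).symm e : V) = e := by
  have h2 := (extChartAt 𝓘(ℂ, V) y).right_inv (by rw [Opens.extChartAt_val_target]; exact he)
  rwa [Opens.extChartAt_val_apply] at h2

/-- The chart image of `S ⊆ Ω` (in any chart of `Ω ⊆ V`) is the image of `S` in `V`. [folklore] -/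
private theorem Opens.chartImage_val_eq (y : Ω) (S : Set Ω) :
    chartImage 𝓘(ℂ, V) y S = (↑) '' S := by
  ext e
  rw [mem_chartImage_iff, Opens.extChartAt_val_target]
  constructor
  · rintro ⟨he, hS⟩
    exact ⟨_, hS, Opens.coe_extChartAt_val_symm y he⟩
  · rintro ⟨z, hz, rfl⟩
    exact ⟨z.2, by rw [Opens.extChartAt_val_symm_apply]; exact hz⟩

/-- A regular point of codimension `c` of `S ⊆ Ω` is a regular point of codimension `c` of the
image of `S` in `V` (model-space form `SCV.IsRegPt`). [folklore] -/
theorem IsRegularPointOfCodim.isRegPt_image_val {S : Set Ω} {c : ℕ} {y : Ω}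
    (h : IsRegularPointOfCodim 𝓘(ℂ, V) S c y) : SCV.IsRegPt ((↑) '' S : Set V) c y := by
  have := h.isRegPt_chartImage (x := y) (Opens.mem_extChartAt_val_source y y)
  rwa [Opens.chartImage_val_eq, Opens.extChartAt_val_apply] at this

end OpensDictionary

/-! ### The nullity theorem -/

section Null

variable {V : Type*} [NormedAddCommGroup V] [NormedSpace ℂ V] [FiniteDimensional ℂ V]
  [MeasurableSpace V] [BorelSpace V] {Ω : TopologicalSpace.Opens V}

/-- The image in `V` of the regular locus of `Z ⊆ Ω` is `𝓗ᵏ`-null as soon as every regular point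
of `Z` has codimension `c` with `2 (dim V - c) < k`. [Chirka, *Complex Analytic Sets*, §3.7 Cor.]
[folklore] -/
theorem hausdorffMeasure_image_regularLocus_eq_zero {Z : Set Ω} {k : ℕ}
    (hk : ∀ y c, y ∈ Z → IsRegularPointOfCodim 𝓘(ℂ, V) Z c y → 2 * (Module.finrank ℂ V - c) < k) :
    μH[k] ((↑) '' regularLocus 𝓘(ℂ, V) Z : Set V) = 0 := by
  refine measure_null_of_locally_null _ fun x hx => ?_
  obtain ⟨y, ⟨hyZ, c, hc⟩, rfl⟩ := hx
  obtain ⟨N, hN, hN0⟩ := (hc.isRegPt_image_val).exists_nhds_hausdorffMeasure_inter_eq_zero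
    (mem_image_of_mem _ hyZ) (hk y c hyZ hc)
  refine ⟨N ∩ (↑) '' regularLocus 𝓘(ℂ, V) Z, inter_mem (mem_nhdsWithin_of_mem_nhds hN)
    self_mem_nhdsWithin, measure_mono_null ?_ hN0⟩
  rintro e ⟨heN, z, hz, rfl⟩
  exact ⟨⟨z, hz.1, rfl⟩, heN⟩

omit [MeasurableSpace V] [BorelSpace V] in
/-- An analytic subset of `Ω` without regular points is empty (regular points are dense).
[cite: Chirka1989, §2.3 Thm.] -/
theorem IsAnalyticSet.eq_empty_of_regularLocus_eq_empty {Z : Set Ω} (hZ : IsAnalyticSet 𝓘(ℂ, V) Z)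
    (h : regularLocus 𝓘(ℂ, V) Z = ∅) : Z = ∅ := by
  have := IsAnalyticSet.subset_closure_regularLocus_holds 𝓘(ℂ, V) Ω hZ
  rw [h, closure_empty, subset_empty_iff] at this
  exact this

/-- **Analytic sets of dimension `≤ d` are `𝓗^{2p}`-null for `p > d`.** Let `Z` be an analytic
subset of the open set `Ω ⊆ V` all of whose regular points have codimension `c` with
`dim V ≤ c + d` ("`dim Z ≤ d`"). Then for every `p > d` the image of `Z` in `V` has
`μHE[2p]`-measure (equivalently `μH[2p]`-measure) zero. Induction on `d`: the regular part is
covered by countably many holomorphic images of balls of real dimension `≤ 2d`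
(`hausdorffMeasure_image_regularLocus_eq_zero`); the singular locus is analytic (Cartan–Whitney)
with regular points of dimension `≤ d - 1` (`IsAnalyticSet.succ_le_codim_singularLocus`).
[cite: Chirka1989, §3.7 Cor., p. 39] -/
theorem IsAnalyticSet.hausdorffMeasure_image_eq_zero {d : ℕ} :
    ∀ {Z : Set Ω}, IsAnalyticSet 𝓘(ℂ, V) Z →
      (∀ y c, y ∈ Z → IsRegularPointOfCodim 𝓘(ℂ, V) Z c y → Module.finrank ℂ V ≤ c + d) →
      ∀ {p : ℕ}, d < p → μH[((2 * p : ℕ) : ℝ)] ((↑) '' Z : Set V) = 0 := by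
  induction d with
  | zero =>
    intro Z hZ hcod p hp
    -- the singular locus is empty
    have hsing : singularLocus 𝓘(ℂ, V) Z = ∅ := by
      have hS := isAnalyticSet_singularLocus_holds 𝓘(ℂ, V) Ω hZ
      refine hS.eq_empty_of_regularLocus_eq_empty (eq_empty_iff_forall_notMem.2 fun y hy => ?_)
      obtain ⟨hyS, c, hc⟩ := hy
      have h1 := hZ.succ_le_codim_singularLocus (c₀ := Module.finrank ℂ V)
        (fun z c hz h => by have := hcod z c hz h; omega) hyS hc
      have h2 := hc.le_finrank
      omega
    have hZeq : Z = regularLocus 𝓘(ℂ, V) Z := by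
      conv_lhs => rw [← regularLocus_union_singularLocus (I := 𝓘(ℂ, V)) Z, hsing, union_empty]
    rw [hZeq]
    exact hausdorffMeasure_image_regularLocus_eq_zero fun y c hy h => by
      have := hcod y c hy h; omega
  | succ d ih =>
    intro Z hZ hcod p hp
    have hS := isAnalyticSet_singularLocus_holds 𝓘(ℂ, V) Ω hZ
    have hreg : μH[((2 * p : ℕ) : ℝ)] ((↑) '' regularLocus 𝓘(ℂ, V) Z : Set V) = 0 :=
      hausdorffMeasure_image_regularLocus_eq_zero fun y c hy h => by
        have := hcod y c hy h; omega
    have hsing : μH[((2 * p : ℕ) : ℝ)] ((↑) '' singularLocus 𝓘(ℂ, V) Z : Set V) = 0 := by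
      refine ih hS (fun y c hy h => ?_) (Nat.lt_of_succ_lt hp)
      have := hZ.succ_le_codim_singularLocus (c₀ := Module.finrank ℂ V - (d + 1))
        (fun z c hz h' => by have := hcod z c hz h'; omega) hy h
      omega
    rw [← regularLocus_union_singularLocus (I := 𝓘(ℂ, V)) Z, image_union]
    exact measure_union_null hreg hsing

/-- `𝓗^{2p}`-nullity for the Euclidean-normalised Hausdorff measure `μHE[2p]`: analytic sets of
dimension `≤ d < p` are `μHE[2p]`-null. [cite: Chirka1989, §3.7 Cor., p. 39] -/
theorem IsAnalyticSet.euclideanHausdorffMeasure_image_eq_zero {Z : Set Ω}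
    (hZ : IsAnalyticSet 𝓘(ℂ, V) Z) {d : ℕ}
    (hcod : ∀ y c, y ∈ Z → IsRegularPointOfCodim 𝓘(ℂ, V) Z c y → Module.finrank ℂ V ≤ c + d)
    {p : ℕ} (hp : d < p) : (μHE[2 * p] : Measure V) ((↑) '' Z : Set V) = 0 := by
  rw [euclideanHausdorffMeasure_def, Measure.smul_apply, hZ.hausdorffMeasure_image_eq_zero hcod hp,
    smul_zero]

/-- **Distinct irreducible analytic sets of pure dimension `p` meet in an `𝓗^{2p}`-null set.** For
`Z ≠ Z'` irreducible analytic subsets of `Ω ⊆ V`, both of pure codimension `c₀ = dim V - p`, the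
image of `Z ∩ Z'` in `V` is `μHE[2p]`-null: its regular points have dimension `< p`
(`IsIrreducibleAnalyticSet.succ_le_codim_inter`, [Chirka1989, §5.3 Cor. 1]), so the nullity
theorem applies. [cite: Chirka1989, §5.3 Cor. 1, p. 55] -/
theorem IsIrreducibleAnalyticSet.euclideanHausdorffMeasure_image_inter_eq_zero {Z Z' : Set Ω}
    (hZ : IsIrreducibleAnalyticSet 𝓘(ℂ, V) Z) (hZ' : IsIrreducibleAnalyticSet 𝓘(ℂ, V) Z') {p c₀ : ℕ}
    (hpc : p + c₀ = Module.finrank ℂ V) (hZc : HasPureCodim 𝓘(ℂ, V) Z c₀)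
    (hZ'c : HasPureCodim 𝓘(ℂ, V) Z' c₀) (hne : Z ≠ Z') :
    (μHE[2 * p] : Measure V) ((↑) '' (Z ∩ Z') : Set V) = 0 := by
  have hY : IsAnalyticSet 𝓘(ℂ, V) (Z ∩ Z') := hZ.1.inter hZ'.1
  rcases Nat.eq_zero_or_pos p with hp | hp
  · -- `p = 0`: the intersection has no regular points, hence is empty
    subst hp
    have hYe : Z ∩ Z' = ∅ := by
      refine hY.eq_empty_of_regularLocus_eq_empty (eq_empty_iff_forall_notMem.2 fun y hy => ?_)
      obtain ⟨hyY, c, hc⟩ := hy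
      have h1 := hZ.succ_le_codim_inter hZ' hZc hZ'c hne hyY hc
      have h2 := hc.le_finrank
      omega
    rw [hYe, image_empty, measure_empty]
  · refine hY.euclideanHausdorffMeasure_image_eq_zero (d := p - 1) (fun y c hy h => ?_) (by omega)
    have := hZ.succ_le_codim_inter hZ' hZc hZ'c hne hy h
    omega

/-- **The singular locus of a `p`-dimensional analytic set is `𝓗^{2p}`-null** ("`𝓗_{2p}(sng A) = 0`",
used in the proof of Lelong's theorem [Chirka1989, §14.1, p. 174]): if every regular point of the
analytic subset `Z` of `Ω ⊆ V` has codimension `≥ c₀` and `p + c₀ = dim V`, then the image of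
`sng Z` in `V` is `μHE[2p]`-null — `sng Z` is analytic (Cartan–Whitney) of dimension `< p`
(`IsAnalyticSet.succ_le_codim_singularLocus`). [cite: Chirka1989, §14.1, p. 174] -/
theorem IsAnalyticSet.euclideanHausdorffMeasure_image_singularLocus_eq_zero {Z : Set Ω}
    (hZ : IsAnalyticSet 𝓘(ℂ, V) Z) {p c₀ : ℕ} (hpc : p + c₀ = Module.finrank ℂ V)
    (hc₀ : ∀ y c, y ∈ Z → IsRegularPointOfCodim 𝓘(ℂ, V) Z c y → c₀ ≤ c) :
    (μHE[2 * p] : Measure V) ((↑) '' singularLocus 𝓘(ℂ, V) Z : Set V) = 0 := by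
  have hS := isAnalyticSet_singularLocus_holds 𝓘(ℂ, V) Ω hZ
  rcases Nat.eq_zero_or_pos p with hp | hp
  · -- `p = 0`: the singular locus has no regular points, hence is empty
    subst hp
    have hSe : singularLocus 𝓘(ℂ, V) Z = ∅ := by
      refine hS.eq_empty_of_regularLocus_eq_empty (eq_empty_iff_forall_notMem.2 fun y hy => ?_)
      obtain ⟨hyS, c, hc⟩ := hy
      have h1 := hZ.succ_le_codim_singularLocus hc₀ hyS hc
      have h2 := hc.le_finrank
      omega
    rw [hSe, image_empty, measure_empty]
  · refine hS.euclideanHausdorffMeasure_image_eq_zero (d := p - 1) (fun y c hy h => ?_) (by omega)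
    have := hZ.succ_le_codim_singularLocus hc₀ hy h
    omega

/-- **`𝓗^{2p}(sng A) = 0` for `A` of pure dimension `p`** (pure codimension `c₀ = dim V - p`).
[cite: Chirka1989, §14.1, p. 174] -/
theorem HasPureCodim.euclideanHausdorffMeasure_image_singularLocus_eq_zero {Z : Set Ω} {p c₀ : ℕ}
    (hZ : HasPureCodim 𝓘(ℂ, V) Z c₀) (hpc : p + c₀ = Module.finrank ℂ V) :
    (μHE[2 * p] : Measure V) ((↑) '' singularLocus 𝓘(ℂ, V) Z : Set V) = 0 :=
  hZ.1.euclideanHausdorffMeasure_image_singularLocus_eq_zero hpc fun y c hy h =>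
    ((hZ.2.2 y ⟨hy, c, h⟩).codim_unique hy h).le

end Null

end Literature.Geometry.Kaehler
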